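import Literature.MathematicalPhysics.QuantumFieldTheory.Balaban1983to89.B6TreeGaugePoincare

/-!
# `Balaban1983to89.B6FaceInterpolation` — B6 (2.124): the interpolation inequality across a face of two
# adjacent blocks, PROVED on the concrete unit-lattice carrier

T. Bałaban, *Propagators for lattice gauge theories in a background field. II*, Commun. Math. Phys. **96**,
223–250 (1984) [Balaban1984PropagatorsII] (cell paper B6), p. 244 bottom [PDF 22] and p. 245 (2.124) [PDF 23].
Renders `1984-cmp96-propagators-rt-II-p022-x2.png`, `…-p023-x2.png` read as images by this seat.

CITATION HEADER (lean-in-tree rule 2026-08-18).  PRINTED, p. 244, verbatim: *"Next let us consider bonds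
b ∈ B(c) = {b : b₋ ∈ B(c₋), b₊ ∈ B(c₊)} for some c ∈ Λ′. Let c = ⟨y, y + Le_μ⟩ and Δ′, Δ″ denote the intersection of
the planes x_μ = c₊,μ − 1 = y_μ + (L − 1), x_μ = c₊,μ = y_μ + L with the blocks B(c₋), B(c₊) correspondingly, as
indicated in the figure below."*  p. 245, verbatim: *"We identify B(b) = B_μ(x) for b = ⟨x, x + e_μ⟩, and we have
Σ_{p⊂B(c)} |(∂₁B)(p)|² ≥ ⅓ Σ_{b⊂Δ′} |(∂B_μ)(b)|² − Σ_{b⊂Δ′} |B(b)|² − Σ_{b⊂Δ″} |B(b)|², (2.124)"*.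

DICTIONARY.  Sites `Fin d → ℤ`, unit bonds ⟨z, z + e_ν⟩ ↦ `(z, ν)`, configurations `B6TreeGaugePoincare.Cfg d`,
blocks `B6Elimination.block L y` = B(y) = {x : y_i ≤ x_i < y_i + L} (B5 (1.6)), unit vectors `B6BondElimination.unitVec`,
plaquette circulation `B6TreeGaugePoincare.curl B z j μ = B(z, j) + B(z + e_j, μ) − B(z + e_μ, j) − B(z, μ)` (= (∂₁B)
of the plaquette with lowest corner z spanned by e_j, e_μ, up to the orientation sign, which is squared away).
* `lastLayer L y μ` = Δ′ = {x ∈ B(y) : x_μ = y_μ + L − 1};  `firstLayer L y μ` = Δ″ = {x ∈ B(y + Le_μ) : x_μ = y_μ + L}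
  (literally the printed planes cut with B(c₋) = B(y), B(c₊) = B(y + Le_μ)); `add_unitVec_mem_firstLayer`: Δ″ = Δ′ + e_μ.
* *"b ⊂ Δ′"* (a bond with both end points in Δ′) ↦ `b ∈ bondsIn (lastLayer L y μ)` (`mem_bondsIn`); such a bond is
  transverse, b = ⟨x, x + e_ν⟩ with ν ≠ μ (`dir_ne_of_mem_bondsIn_lastLayer`); likewise *"b ⊂ Δ″"*.
* (∂B_μ)(b) = B_μ(x + e_ν) − B_μ(x) = `B (x + e_ν, μ) − B (x, μ)` for b = ⟨x, x + e_ν⟩ ⊂ Δ′ (the printed identification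
  B(b) = B_μ(x) for b = ⟨x, x + e_μ⟩).
* *"p ⊂ B(c)"* ↦ the plaquettes p(b), b = ⟨x, x + e_ν⟩ ⊂ Δ′, with corners x, x + e_ν ∈ Δ′ ⊂ B(c₋) and x + e_μ,
  x + e_μ + e_ν ∈ Δ″ ⊂ B(c₊) — the plaquettes built of two bonds of B(c) (the crossing bonds ⟨x, x + e_μ⟩,
  ⟨x + e_ν, x + e_ν + e_μ⟩), one bond b ⊂ Δ′ and one bond b + e_μ ⊂ Δ″; b ↦ p(b) is a bijection onto them, so
  Σ_{p⊂B(c)} |(∂₁B)(p)|² = Σ_{b⊂Δ′} |curl B x ν μ|².  This is the reading certified in the cell's prose repair of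
  Lemma 2.4 (GAPS G-B6-09R §7 item 3 / G-B6-10: "∂B(p(b)) = ±[−∂B_μ(b′) + B(b″) − B(b′)], bijection P(c) ↔ {b ⊂ Δ′}").

THIS FILE PROVES (journal node G-B6-2124-KERNEL of the cell `pub-balaban`; imports `B6TreeGaugePoincare` only, edits
nothing): `curl_face` — the printed identity behind (2.124): for b = ⟨x, x + e_ν⟩ ⊂ Δ′,
(∂₁B)(p(b)) = (∂B_μ)(b) + B(b) − B(b + e_μ); `sq_third_le` — (a + b − c)² ≥ ⅓a² − b² − c²; `sum_bondsIn_firstLayer` —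
Σ_{b⊂Δ″} f(b) = Σ_{b⊂Δ′} f(b + e_μ) (shift bijection); and **`ineq2124`** — (2.124) exactly as displayed:
⅓ Σ_{b⊂Δ′} |(∂B_μ)(b)|² − Σ_{b⊂Δ′} |B(b)|² − Σ_{b⊂Δ″} |B(b)|² ≤ Σ_{b⊂Δ′} |(∂₁B)(p(b))|², for every configuration B
(no gauge condition is used — as the cell's census remarks, (2.124)–(2.126) hold for arbitrary B), every d, L ≥ 1,
y ∈ Z^d, μ.

HONEST SCOPE.  One printed display, kernel-checked on the literal carrier; (2.125)–(2.127) and the assembly of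
Lemma 2.4 are NOT touched here (`B6.lean`: `Step2127` hypothesis, `lemma24K_of_steps`; `B6Lemma24Carrier.lean`:
`Step2123` proved on the carrier).  A successor proving `B6.Step2127` on `B6Lemma24Carrier.carrier` needs, besides
this file, (2.125) (contour regrouping + Cauchy–Schwarz), the (d − 1)-dimensional grid Poincaré inequality with the
repaired factor κ_L (census G-B6-10 Step 3 / 3′), and the bookkeeping that the families p(b), b ⊂ Δ′(c), over the
coarse bonds c are pairwise disjoint and disjoint from the in-block plaquettes.  Value = kernel node for the printed
step (2.124), NOT summit progress.  Unit b2b-balaban-pv09-g4 (surge node prover #09 gen 4); staged byte-identically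
under `HOME/lean/BalabanYm4/`.
-/

open Finset

namespace Literature.MathematicalPhysics.QuantumFieldTheory.Balaban1983to89.B6FaceInterpolation

open B6Elimination (block mem_block)
open B6BondElimination (unitVec unitVec_apply add_unitVec_apply add_smul_unitVec_apply)
open B6TreeGaugePoincare (Cfg curl)

noncomputable section

variable {d : ℕ} {L : ℕ}

/-! ## §1  The two layers Δ′, Δ″ of the face c = ⟨y, y + Le_μ⟩ and the bonds inside them -/

/-- Δ′ = the intersection of the plane x_μ = y_μ + (L − 1) with the block B(c₋) = B(y) (the last layer of B(y) in
the direction μ). [cite: Balaban1984PropagatorsII, p.244] -/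
def lastLayer (L : ℕ) (y : Fin d → ℤ) (μ : Fin d) : Finset (Fin d → ℤ) :=
  (block L y).filter fun x => x μ = y μ + L - 1

/-- Δ″ = the intersection of the plane x_μ = y_μ + L with the block B(c₊) = B(y + Le_μ) (the first layer of B(c₊)).
[cite: Balaban1984PropagatorsII, p.244] -/
def firstLayer (L : ℕ) (y : Fin d → ℤ) (μ : Fin d) : Finset (Fin d → ℤ) :=
  (block L (y + (L : ℤ) • unitVec μ)).filter fun x => x μ = y μ + L

/-- Membership in Δ′. [folklore] -/
theorem mem_lastLayer {y x : Fin d → ℤ} {μ : Fin d} :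
    x ∈ lastLayer L y μ ↔ x ∈ block L y ∧ x μ = y μ + L - 1 := mem_filter

/-- Membership in Δ″. [folklore] -/
theorem mem_firstLayer {y x : Fin d → ℤ} {μ : Fin d} :
    x ∈ firstLayer L y μ ↔ x ∈ block L (y + (L : ℤ) • unitVec μ) ∧ x μ = y μ + L := mem_filter

/-- Δ″ = Δ′ + e_μ: x + e_μ ∈ Δ″ iff x ∈ Δ′ (L ≥ 1). [folklore] -/
theorem add_unitVec_mem_firstLayer (hL : 1 ≤ L) {y x : Fin d → ℤ} {μ : Fin d} :
    x + unitVec μ ∈ firstLayer L y μ ↔ x ∈ lastLayer L y μ := by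
  rw [mem_firstLayer, mem_lastLayer, mem_block, mem_block]
  have e1 : ∀ i, (x + unitVec μ) i = x i + if i = μ then 1 else 0 := fun i => add_unitVec_apply x μ i
  have e2 : ∀ i, (y + (L : ℤ) • unitVec μ) i = y i + if i = μ then (L : ℤ) else 0 :=
    fun i => add_smul_unitVec_apply y (L : ℤ) μ i
  constructor
  · rintro ⟨hb, hμ⟩
    rw [e1, if_pos rfl] at hμ
    refine ⟨fun i => ?_, by omega⟩
    have hi := hb i
    rw [e1, e2] at hi
    split_ifs at hi with h
    · subst h; omega
    · omega
  · rintro ⟨hb, hμ⟩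
    refine ⟨fun i => ?_, by rw [e1, if_pos rfl]; omega⟩
    have hi := hb i
    rw [e1, e2]
    split_ifs with h
    · subst h; omega
    · omega

/-- The bonds *"b ⊂ S"*: unit bonds ⟨z, z + e_ν⟩ with both end points in the finite set S of sites. [folklore] -/
def bondsIn (S : Finset (Fin d → ℤ)) : Finset ((Fin d → ℤ) × Fin d) :=
  (S ×ˢ (univ : Finset (Fin d))).filter fun b => b.1 + unitVec b.2 ∈ S

/-- Membership in the bonds inside S. [folklore] -/
theorem mem_bondsIn {S : Finset (Fin d → ℤ)} {b : (Fin d → ℤ) × Fin d} :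
    b ∈ bondsIn S ↔ b.1 ∈ S ∧ b.1 + unitVec b.2 ∈ S := by
  simp only [bondsIn, mem_filter, mem_product, mem_univ, and_true]

/-- A bond inside Δ′ is transverse to the face: b = ⟨x, x + e_ν⟩ ⊂ Δ′ forces ν ≠ μ. [folklore] -/
theorem dir_ne_of_mem_bondsIn_lastLayer {y : Fin d → ℤ} {μ : Fin d} {b : (Fin d → ℤ) × Fin d}
    (hb : b ∈ bondsIn (lastLayer L y μ)) : b.2 ≠ μ := by
  intro h
  obtain ⟨h1, h2⟩ := mem_bondsIn.1 hb
  have e1 := (mem_lastLayer.1 h1).2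
  have e2 := (mem_lastLayer.1 h2).2
  rw [add_unitVec_apply, if_pos h.symm] at e2
  omega

/-- **Shift bijection Δ′ → Δ″ on bonds**: Σ_{b⊂Δ″} f(b) = Σ_{b⊂Δ′} f(b + e_μ) (L ≥ 1). [folklore] -/
theorem sum_bondsIn_firstLayer (hL : 1 ≤ L) (y : Fin d → ℤ) (μ : Fin d) (f : (Fin d → ℤ) × Fin d → ℝ) :
    ∑ b ∈ bondsIn (firstLayer L y μ), f b = ∑ b ∈ bondsIn (lastLayer L y μ), f (b.1 + unitVec μ, b.2) := by
  refine Finset.sum_nbij' (fun b => (b.1 - unitVec μ, b.2)) (fun b => (b.1 + unitVec μ, b.2)) ?_ ?_ ?_ ?_ ?_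
  · intro b hb
    obtain ⟨h1, h2⟩ := mem_bondsIn.1 hb
    refine mem_bondsIn.2 ⟨(add_unitVec_mem_firstLayer hL).1 (by rwa [sub_add_cancel]), ?_⟩
    refine (add_unitVec_mem_firstLayer hL).1 ?_
    have e : b.1 - unitVec μ + unitVec b.2 + unitVec μ = b.1 + unitVec b.2 := by abel
    rw [e]
    exact h2
  · intro b hb
    obtain ⟨h1, h2⟩ := mem_bondsIn.1 hb
    refine mem_bondsIn.2 ⟨(add_unitVec_mem_firstLayer hL).2 h1, ?_⟩
    have e : b.1 + unitVec μ + unitVec b.2 = b.1 + unitVec b.2 + unitVec μ := add_right_comm _ _ _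
    rw [e]
    exact (add_unitVec_mem_firstLayer hL).2 h2
  · intro b _
    simp only [sub_add_cancel, Prod.mk.eta]
  · intro b _
    simp only [add_sub_cancel_right, Prod.mk.eta]
  · intro b _
    simp only [sub_add_cancel, Prod.mk.eta]

/-! ## §2  The plaquettes p(b) across the face and the inequality (2.124) -/

/-- **The printed identity behind (2.124).**  For a bond b = ⟨x, x + e_ν⟩ the circulation of B around the plaquette
p(b) with corners x, x + e_ν, x + e_μ + e_ν, x + e_μ is (∂B_μ)(b) + B(b) − B(b + e_μ), where (∂B_μ)(b) =
B_μ(x + e_ν) − B_μ(x) and b + e_μ = ⟨x + e_μ, x + e_μ + e_ν⟩ (for b ⊂ Δ′ this is the bond b″ ⊂ Δ″ facing b).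
[cite: Balaban1984PropagatorsII, (2.124) p.245; dictionary] -/
theorem curl_face (B : Cfg d) (b : (Fin d → ℤ) × Fin d) (μ : Fin d) :
    curl B b.1 b.2 μ = (B (b.1 + unitVec b.2, μ) - B (b.1, μ)) + B b - B (b.1 + unitVec μ, b.2) := by
  unfold curl
  rw [Prod.mk.eta]
  ring

/-- The elementary inequality (a + b − c)² ≥ ⅓a² − b² − c² (3((a + b − c)² + b² + c²) − a² = (a + 2b − c)² +
(a + b − 2c)² + (b + c)²; cf. `B6.sq_sum_third`). [folklore] -/
theorem sq_third_le (a b c : ℝ) : a ^ 2 / 3 - b ^ 2 - c ^ 2 ≤ (a + b - c) ^ 2 := by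
  nlinarith [sq_nonneg (a + 2 * b - c), sq_nonneg (a + b - 2 * c), sq_nonneg (b + c)]

/-- **B6 (2.124), PROVED** (every configuration B, every d, L ≥ 1, y ∈ Z^d, μ):
⅓ Σ_{b⊂Δ′} |(∂B_μ)(b)|² − Σ_{b⊂Δ′} |B(b)|² − Σ_{b⊂Δ″} |B(b)|² ≤ Σ_{p⊂B(c)} |(∂₁B)(p)|², the right side written as
Σ_{b = ⟨x, x+e_ν⟩ ⊂ Δ′} |curl B x ν μ|² over the plaquettes p(b) across the face c = ⟨y, y + Le_μ⟩ (bijection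
b ↦ p(b), see the file header).  Pointwise `curl_face` + `sq_third_le`, and the shift bijection
`sum_bondsIn_firstLayer` for the Δ″-sum. [cite: Balaban1984PropagatorsII, (2.124) p.245; proved] -/
theorem ineq2124 (hL : 1 ≤ L) (y : Fin d → ℤ) (μ : Fin d) (B : Cfg d) :
    (1 / 3 : ℝ) * ∑ b ∈ bondsIn (lastLayer L y μ), (B (b.1 + unitVec b.2, μ) - B (b.1, μ)) ^ 2
      - ∑ b ∈ bondsIn (lastLayer L y μ), B b ^ 2 - ∑ b ∈ bondsIn (firstLayer L y μ), B b ^ 2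
      ≤ ∑ b ∈ bondsIn (lastLayer L y μ), curl B b.1 b.2 μ ^ 2 := by
  rw [sum_bondsIn_firstLayer hL y μ, Finset.mul_sum, ← Finset.sum_sub_distrib, ← Finset.sum_sub_distrib]
  refine Finset.sum_le_sum fun b _ => ?_
  rw [curl_face]
  have h := sq_third_le (B (b.1 + unitVec b.2, μ) - B (b.1, μ)) (B b) (B (b.1 + unitVec μ, b.2))
  linarith

/-- (2.124) in the *"≥"* orientation of the print. [cite: Balaban1984PropagatorsII, (2.124) p.245; proved] -/
theorem ineq2124_ge (hL : 1 ≤ L) (y : Fin d → ℤ) (μ : Fin d) (B : Cfg d) :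
    ∑ b ∈ bondsIn (lastLayer L y μ), curl B b.1 b.2 μ ^ 2 ≥
      (1 / 3 : ℝ) * ∑ b ∈ bondsIn (lastLayer L y μ), (B (b.1 + unitVec b.2, μ) - B (b.1, μ)) ^ 2
        - ∑ b ∈ bondsIn (lastLayer L y μ), B b ^ 2 - ∑ b ∈ bondsIn (firstLayer L y μ), B b ^ 2 :=
  ineq2124 hL y μ B

/-! ## §3  Fidelity of p(b): its corners lie in Δ′ ⊂ B(c₋) and Δ″ ⊂ B(c₊) -/

/-- Δ′ ⊂ B(c₋) = B(y). [folklore] -/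
theorem lastLayer_subset_block (y : Fin d → ℤ) (μ : Fin d) : lastLayer L y μ ⊆ block L y :=
  filter_subset _ _

/-- Δ″ ⊂ B(c₊) = B(y + Le_μ). [folklore] -/
theorem firstLayer_subset_block (y : Fin d → ℤ) (μ : Fin d) :
    firstLayer L y μ ⊆ block L (y + (L : ℤ) • unitVec μ) :=
  filter_subset _ _

/-- For b = ⟨x, x + e_ν⟩ ⊂ Δ′ the four corners of p(b): x, x + e_ν ∈ Δ′ and x + e_μ, x + e_ν + e_μ ∈ Δ″ — so p(b)
consists of the two crossing bonds ⟨x, x + e_μ⟩, ⟨x + e_ν, x + e_ν + e_μ⟩ ∈ B(c), the bond b ⊂ Δ′ and the bond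
b + e_μ ⊂ Δ″ (*"p ⊂ B(c)"*). [cite: Balaban1984PropagatorsII, p.244–245; dictionary] -/
theorem face_plaquette_corners (hL : 1 ≤ L) {y : Fin d → ℤ} {μ : Fin d} {b : (Fin d → ℤ) × Fin d}
    (hb : b ∈ bondsIn (lastLayer L y μ)) :
    b.1 ∈ lastLayer L y μ ∧ b.1 + unitVec b.2 ∈ lastLayer L y μ ∧
      b.1 + unitVec μ ∈ firstLayer L y μ ∧ b.1 + unitVec b.2 + unitVec μ ∈ firstLayer L y μ := by
  obtain ⟨h1, h2⟩ := mem_bondsIn.1 hb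
  exact ⟨h1, h2, (add_unitVec_mem_firstLayer hL).2 h1, (add_unitVec_mem_firstLayer hL).2 h2⟩

end

end Literature.MathematicalPhysics.QuantumFieldTheory.Balaban1983to89.B6FaceInterpolation
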